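import Summits.ValiantsHypothesis.ValiantsHypothesis.Theses.PrincipalMinorColouring
import Literature.Computability.AlgebraicComplexity.ReadKDeterminantalRepresentationsProofs
import Summits.ValiantsHypothesis.ValiantsHypothesis.Theorems.PrincipalMinorColouringBorderBoundedRankCount
import Summits.ValiantsHypothesis.ValiantsHypothesis.Theorems.PrincipalMinorColouringBorderBoundedRankTransport

/-!
# Route PrincipalMinorColouring — item `BorderBoundedRank` (stmt-ValiantsHypothesis-3778, aside · rank 4) PROVED:
# border bounded-rank impossibility for EVERY fixed class size `r`

`BorderBoundedRank`: for every `r` there is `n₀` such that for all `n ≥ n₀`, all `R` and all colourings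
`κ : Fin R → Fin n × Fin n` with colour classes of size `≤ r`, the coefficient function of `per_n(x+J)` is NOT in the
closure (product topology on coefficient functions) of the coefficient functions of `n!·det(I_R + diag(x∘κ)·K)`,
`K ∈ ℂ^{R×R}`.

Proof = the line `closure_counting` of the `r = 2` rung (stmt-21038, planner val-width-lines-2; stubs landed by seats
val-width-21038-p1 and val-width-21038-p2) with `2 ↦ r`, exactly as its line card predicts: with `k = k(r) = 8(r+2)` placed diagonal
variables `ζ i = (i, i)` and `n ≥ |V k| + k`,
* universality of the permanent (`exists_subst_perPoly_eq`, tree; `char ℂ ≠ 2`) realises EVERY `c : (Fin k → Bool) → ℂ`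
  as the coefficient family of a substitution `S(per_n)`, constants outside `ζ`;
* `transport_le r` (`…BorderBoundedRankTransport`): border membership ⇒ each such `c` lies in the closure of
  `⋃_{s ≤ r·k} ⋃_ι range (nfMap k s ι)` (continuity of coefficient functionals on the degree-`R` box + one bordering +
  Hrubeš–Joglekar Lemma 1; classes `≤ r` give `≤ r·k` slots);
* `two_pow_le_of_dense_iUnion_nfMap (r·k) k` (`…BorderBoundedRankCount`): a dense finite union of polynomial images with
  `≤ 1 + (2rk)²` parameters forces `2^k ≤ 1 + (2rk)²` (closure-robust Hrubeš–Joglekar Thm. 2);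
* `one_add_sq_lt_two_pow_slots r`: `1 + (2·r·k(r))² < 2^{k(r)}` — contradiction.

Prover seat val-width-21038-p2 g0 (cell val-width). No definitions. CALIBRATION (honest): for each FIXED `r` this is a
corollary of Hrubeš–Joglekar 2025 (read-`k` determinantal representations, in tree) made closure-robust; `n₀(r)` is
of order `|V 8(r+2)|` (exponential in `r`), so nothing is said about `r` growing with `n` beyond HJ25's own range; the
route's open content `TotalRankNotQP` (stmt-3775) is untouched. VP ≠ VNP is not moved.
-/

-- `Summit.ValiantsHypothesis.ValiantsHypothesis.…` is the tree's mandated single-conjunct layout (Sub = Summit).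
set_option linter.dupNamespace false

namespace Summit.ValiantsHypothesis.ValiantsHypothesis.Theorems

open MvPolynomial Matrix
open Literature.Computability.AlgebraicComplexity
open Summit.ValiantsHypothesis.ValiantsHypothesis.Theses.PrincipalMinorColouring
open Summit.ValiantsHypothesis.ValiantsHypothesis.Theorems.BorderBoundedRankTwoClosureCounting

/-- **`BorderBoundedRank` (stmt-ValiantsHypothesis-3778) holds**: for every class size `r`, with
`n₀ = |V (8(r+2))| + 8(r+2)`, for all `n ≥ n₀`, all `R` and all colourings `κ` of `Fin R` by matrix positions with
classes of size `≤ r`, the coefficient function of `per_n(x+J)` is not in the closure of the coefficient functions of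
`n!·det(1 + diag(X∘κ)·K)`, `K ∈ ℂ^{R×R}`. Composition of universality (`exists_subst_perPoly_eq`), the transport
`transport_le r`, the count `two_pow_le_of_dense_iUnion_nfMap`, and the arithmetic `one_add_sq_lt_two_pow_slots`.
[cite: HrubesJoglekar2025, Cor. 8 (p. 53:6)] -/
theorem borderBoundedRank_proof : BorderBoundedRank := by
  intro r
  refine ⟨Fintype.card (ReadOnceTree.V (8 * (r + 2))) + 8 * (r + 2), fun n hn R κ hκ hv => ?_⟩
  have hVn : Fintype.card (ReadOnceTree.V (8 * (r + 2))) ≤ n := by omega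
  have hkn : 8 * (r + 2) ≤ n := by omega
  set ζ : Fin (8 * (r + 2)) → Fin n × Fin n := fun i => (Fin.castLE hkn i, Fin.castLE hkn i) with hζ
  have hrow : Function.Injective fun i => (ζ i).1 := fun i j h =>
    Fin.castLE_injective hkn (by simpa [hζ] using h)
  have hcol : Function.Injective fun i => (ζ i).2 := fun i j h =>
    Fin.castLE_injective hkn (by simpa [hζ] using h)
  have hζinj : Function.Injective ζ := fun i j h => hrow (congrArg Prod.fst h)
  have hF : ringChar ℂ ≠ 2 := by rw [ringChar.eq_zero]; norm_num
  have hall : ∀ c : (Fin (8 * (r + 2)) → Bool) → ℂ, c ∈ closure (⋃ (s : Fin (r * (8 * (r + 2)) + 1)),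
      ⋃ (ι : Fin (s : ℕ) → Fin (8 * (r + 2))), Set.range (nfMap (8 * (r + 2)) s ι)) := by
    intro c
    obtain ⟨S, hS1, hS2, hS3⟩ := exists_subst_perPoly_eq hF hVn ζ hrow hcol c
    exact transport_le r n R κ hκ hv (8 * (r + 2)) ζ hζinj S c hS1 hS2 hS3
  have h1 := two_pow_le_of_dense_iUnion_nfMap (r * (8 * (r + 2))) (8 * (r + 2)) hall
  have h2 := one_add_sq_lt_two_pow_slots r
  omega

end Summit.ValiantsHypothesis.ValiantsHypothesis.Theorems
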